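import Summits.ResolutionOfSingularities.ResolutionOfSingularities.Theorems.HilbertSamuelEliminationCampaignW42ToricMarkedLambda

/-!
# [OURS · L1 W4.2] Toric marked monomial objects in dimension 3 — brick 9A: the TWO-RAY DISCIPLINE `Q₂` (dummy ray, member faces only)

[OURS · L1 W4.2 · seat res-L1-s42-pv-2 gen 6] replaces the role of the «k = 2 exact corner» sub-discipline of the σ-design cell inside
`stub_Wtop_elimination` (CHAIN w42 v3.22 §0u.3 (KR′), planner WORD (o-KR)/(d-δ) 2026-08-27T16:01:30Z: at a live exact group with TWO member
rays `a, b` the board-changing moves are the MEMBER FACES ONLY — the legal singletons `{a}`, `{b}`, the pair `{a, b}` and their descendants, NO point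
move); NOT a statement of the manuscript under review ([Hironaka2017] is a CANDIDATE, never a premise), nor of [CossartJannsenSaito2020],
[Spivakovsky1983] or [Blanco 2012].  AI work, weaker than expert review.

## What this file is

A `k = 2` exact corner embeds into the id-model `TState` (brick 1, `…ToricMarkedDefs`) with a DUMMY third ray `d` carrying exponent `0` in every
generator.  The two-ray discipline is the restriction of the legal play to faces NOT containing `d` (`PlayAvoid m d`); along it `d` stays in every
cone and keeps exponent `0` (`DummyRay.move`), so the dynamics is the E-resolution game of a marked MONOMIAL ideal on a smooth toric SURFACE
(cones = the pairs `C ∖ d`; singleton move = blow-up of the invariant curve, pair move = blow-up of the fixed point).  This file fixes the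
definitions (`PlayAvoid`, `EResolvableAvoiding`, `DummyRay`, the cone potential `pot2 = lex(pair width T of brick 4A, Σβ)` and the measure `nu`)
and proves the two PER-MOVE DECREASE lemmas of the 2-dimensional termination argument: a legal singleton move is a translation of the planar
exponent configuration (`T` unchanged, `Σβ` drops by `m`) — `pot2_singleton_child_lt`; the pair move of a cone none of whose two singletons is
legal (both rays reduced, `β < m`) replaces it by two children of strictly smaller potential (`T` drops when positive by `PairPot.T_child1_lt /
T_child2_lt`; `T = 0` is the principal configuration and `Σβ` drops by `PairPot.minsum_child*_lt`) — `pot2_pair_child_lt`.  The Dershowitz–Manna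
assembly and the theorem «every dummy-ray state is E-resolvable by the two-ray discipline» are brick 9B (`…ToricMarkedTwoRayKernel`).
The hypothesis `a_d ≡ 0` is necessary: with `m = 2` and one generator `u_d⁵` the corner is unresolved and no `d`-avoiding face is legal.

Every `theorem` is fully proved; no `sorry`, no new axiom.
-/

set_option linter.dupNamespace false -- mandated namespace of this single-conjunct summit

namespace Summit.ResolutionOfSingularities.ResolutionOfSingularities.Theorems.CampaignW42.Toric

open Finset

/-! ### Two more facts on the pair-width potential (brick 4A §A) -/

namespace PairPot

variable {γ : Type}

/-- The number of incomparable ordered pairs is non-negative. -/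
theorem zero_le_N (G : Finset γ) (x y : γ → ℤ) : 0 ≤ N G x y :=
  Finset.sum_nonneg (fun g _ => Finset.sum_nonneg (fun g' _ => ind_nonneg x y g g'))

/-- `T` never increases under the first child map `(x, y) ↦ (x, x + y − c)`. -/
theorem T_child1_le_self (G : Finset γ) (x y : γ → ℤ) (c : ℤ) : T G x (fun g => x g + y g - c) ≤ T G x y := by
  have h1 := T_child1_add_N_le G x y c
  have h2 := zero_le_N G x y
  omega

/-- `T` never increases under the second child map `(x, y) ↦ (x + y − c, y)`. -/
theorem T_child2_le_self (G : Finset γ) (x y : γ → ℤ) (c : ℤ) : T G (fun g => x g + y g - c) y ≤ T G x y := by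
  have h1 := T_child2_add_N_le G x y c
  have h2 := zero_le_N G x y
  omega

end PairPot

namespace TState

section Discipline

variable {ι : Type}

/-- **[OURS · L1 W4.2]** `PlayAvoid m d s t`: `t` is reached from `s` by LEGAL blow-ups of faces NOT containing the ray `d`
(the two-ray discipline `Q₂` when `d` is the dummy ray of a `k = 2` corner: member faces only, no point move). -/
inductive PlayAvoid (m : ℕ) (d : ℕ) : TState ι → TState ι → Prop
  | refl (s : TState ι) : PlayAvoid m d s s
  | step {s t : TState ι} (R : Finset ℕ) : s.Legal m R → d ∉ R → PlayAvoid m d (s.move m R) t → PlayAvoid m d s t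

/-- **[OURS · L1 W4.2]** The state is E-resolvable by the two-ray discipline off `d`. -/
def EResolvableAvoiding (m d : ℕ) (s : TState ι) : Prop := ∃ t, s.PlayAvoid m d t ∧ t.EResolved m

/-- **[OURS · L1 W4.2]** DUMMY-RAY state: every maximal cone contains `d`, and `d` has exponent `0` in every generator. -/
def DummyRay (d : ℕ) (s : TState ι) : Prop := (∀ C ∈ s.cones, d ∈ C) ∧ ∀ v, s.expo d v = 0

/-- A `d`-avoiding play is a play. -/
theorem PlayAvoid.toPlay {m d : ℕ} {s t : TState ι} (h : s.PlayAvoid m d t) : s.Play m t := by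
  induction h with
  | refl s => exact Play.refl s
  | step R hR _ _ ih => exact Play.step R hR ih

/-- `PlayAvoid` is transitive. -/
theorem PlayAvoid.trans {m d : ℕ} {s t u : TState ι} (h₁ : s.PlayAvoid m d t) (h₂ : t.PlayAvoid m d u) : s.PlayAvoid m d u := by
  induction h₁ with
  | refl s => exact h₂
  | step R hR hd _ ih => exact PlayAvoid.step R hR hd (ih h₂)

/-- E-resolvability by the two-ray discipline implies E-resolvability. -/
theorem EResolvableAvoiding.eresolvable {m d : ℕ} {s : TState ι} (h : s.EResolvableAvoiding m d) : s.EResolvable m := by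
  obtain ⟨t, ht, hres⟩ := h
  exact ⟨t, ht.toPlay, hres⟩

/-- In a well-formed dummy-ray state with a face, the dummy ray is already named (`d < next`). -/
theorem DummyRay.lt_next {d : ℕ} {s : TState ι} (h : s.DummyRay d) (hwf : s.WF) {R : Finset ℕ} (hR : s.IsFace R) : d < s.next := by
  obtain ⟨-, C, hC, -⟩ := hR
  exact (hwf C hC).2 d (h.1 C hC)

/-- **The dummy ray survives every `d`-avoiding blow-up**: it stays in every cone and keeps exponent `0`. -/
theorem DummyRay.move {m d : ℕ} {s : TState ι} (h : s.DummyRay d) (hwf : s.WF) {R : Finset ℕ} (hR : s.IsFace R) (hdR : d ∉ R) :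
    (s.move m R).DummyRay d := by
  have hdn : d ≠ s.next := ne_of_lt (h.lt_next hwf hR)
  refine ⟨fun D hD => ?_, fun v => by rw [move_expo_of_ne hdn]; exact h.2 v⟩
  rw [mem_move_cones] at hD
  obtain ⟨C, hC, hDC⟩ := hD
  by_cases hRC : R ⊆ C
  · rw [children_of_subset hRC, Finset.mem_image] at hDC
    obtain ⟨x, hx, rfl⟩ := hDC
    have hdx : d ≠ x := fun h' => hdR (h' ▸ hx)
    exact Finset.mem_insert_of_mem (Finset.mem_erase.mpr ⟨hdx, h.1 C hC⟩)
  · rw [children_of_not_subset hRC, Finset.mem_singleton] at hDC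
    rw [hDC]; exact h.1 C hC

/-- Along a `d`-avoiding play, well-formedness, non-negativity and the dummy ray are preserved. -/
theorem DummyRay.playAvoid {m d : ℕ} {s t : TState ι} (hp : s.PlayAvoid m d t) (hwf : s.WF) (hnn : s.Nonneg) (h : s.DummyRay d) :
    t.WF ∧ t.Nonneg ∧ t.DummyRay d := by
  induction hp with
  | refl s => exact ⟨hwf, hnn, h⟩
  | step R hR hdR _ ih => exact ih (hwf.move R) (hnn.move hR) (h.move hwf hR.1 hdR)

/-- In a dummy-ray state the order along a cone is the order along its member pair `C ∖ d`. -/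
theorem DummyRay.faceSum_erase {d : ℕ} {s : TState ι} (h : s.DummyRay d) {C : Finset ℕ} (hC : C ∈ s.cones) (v : ι) :
    s.faceSum (C.erase d) v = s.faceSum C v := by
  unfold faceSum
  have := Finset.sum_erase_add C (fun r => s.expo r v) (h.1 C hC)
  rw [h.2 v, add_zero] at this
  exact this

/-- The member pair of a cone of a well-formed dummy-ray state has two elements. -/
theorem DummyRay.exists_pair {d : ℕ} {s : TState ι} (h : s.DummyRay d) (hwf : s.WF) {C : Finset ℕ} (hC : C ∈ s.cones) :
    ∃ a b, a ≠ b ∧ C.erase d = {a, b} := by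
  have hcard : (C.erase d).card = 2 := by rw [Finset.card_erase_of_mem (h.1 C hC), (hwf C hC).1]
  exact Finset.card_eq_two.mp hcard

end Discipline

/-! ### Small finset identities for the children of a cone -/

section FinsetLemmas

/-- The member pair of the child `(C ∖ x) ∪ {ρ}` is `((C ∖ d) ∖ x) ∪ {ρ}`. -/
theorem erase_child_eq {C : Finset ℕ} {x d ρ : ℕ} (hρd : ρ ≠ d) :
    (insert ρ (C.erase x)).erase d = insert ρ ((C.erase d).erase x) := by
  ext r
  simp only [Finset.mem_erase, Finset.mem_insert]
  constructor
  · rintro ⟨hrd, hr | ⟨hrx, hrC⟩⟩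
    · exact Or.inl hr
    · exact Or.inr ⟨hrx, hrd, hrC⟩
  · rintro (hr | ⟨hrx, hrd, hrC⟩)
    · exact ⟨by rw [hr]; exact hρd, Or.inl hr⟩
    · exact ⟨hrd, Or.inr ⟨hrx, hrC⟩⟩

/-- Erasing the first element of a pair. -/
theorem pair_erase_left {a b : ℕ} (hab : a ≠ b) : ({a, b} : Finset ℕ).erase a = {b} :=
  Finset.erase_insert (by simp [hab])

/-- Erasing the second element of a pair. -/
theorem pair_erase_right {a b : ℕ} (hab : a ≠ b) : ({a, b} : Finset ℕ).erase b = {a} := by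
  rw [Finset.pair_comm]; exact Finset.erase_insert (by simp [hab.symm])

end FinsetLemmas

/-! ### The cone potential of the two-ray discipline -/

section Potential

variable {ι : Type} [Fintype ι] [Nonempty ι]

/-- **[OURS · L1 W4.2]** The PAIR WIDTH of the cone `C` off the ray `d`: the potential `T` (brick 4A) of the planar configuration
`v ↦ (a_i(v), a_j(v))` over all generators, `{i, j} = C ∖ d` (order-independent by `PairPot.T_symm`; `0` if `C ∖ d` is empty). -/
noncomputable def widthT (s : TState ι) (d : ℕ) (C : Finset ℕ) : ℤ :=
  if h : (C.erase d).Nonempty then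
    PairPot.T (Finset.univ : Finset ι) (s.expo ((C.erase d).min' h)) (s.expo ((C.erase d).max' h))
  else 0

/-- **[OURS · L1 W4.2]** The CONE POTENTIAL of the two-ray discipline: `lex(pair width, Σ_{C ∖ d} β)`. -/
noncomputable def pot2 (s : TState ι) (d : ℕ) (C : Finset ℕ) : ℕ ×ₗ ℕ :=
  toLex ((s.widthT d C).toNat, (s.betaSum (C.erase d)).toNat)

/-- **[OURS · L1 W4.2]** The MEASURE of the two-ray discipline: the multiset of cone potentials. -/
noncomputable def nu (s : TState ι) (d : ℕ) : Multiset (ℕ ×ₗ ℕ) := s.cones.val.map (s.pot2 d)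

omit [Nonempty ι] in
/-- The pair width read with any labelling of the member pair. -/
theorem widthT_eq {s : TState ι} {d : ℕ} {C : Finset ℕ} {i j : ℕ} (hij : i ≠ j) (hC : C.erase d = {i, j}) :
    s.widthT d C = PairPot.T Finset.univ (s.expo i) (s.expo j) := by
  unfold widthT
  have hne : (C.erase d).Nonempty := by rw [hC]; exact ⟨i, by simp⟩
  rw [dif_pos hne]
  have hmin : (C.erase d).min' hne ∈ ({i, j} : Finset ℕ) := by rw [← hC]; exact Finset.min'_mem _ _
  have hmax : (C.erase d).max' hne ∈ ({i, j} : Finset ℕ) := by rw [← hC]; exact Finset.max'_mem _ _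
  have hcard : 1 < (C.erase d).card := by rw [hC, Finset.card_pair hij]; decide
  have hlt : (C.erase d).min' hne < (C.erase d).max' hne := Finset.min'_lt_max'_of_card _ hcard
  simp only [Finset.mem_insert, Finset.mem_singleton] at hmin hmax
  rcases hmin with h1 | h1 <;> rcases hmax with h2 | h2
  · rw [h1, h2] at hlt; exact absurd hlt (lt_irrefl _)
  · rw [h1, h2]
  · rw [h1, h2, PairPot.T_symm]
  · rw [h1, h2] at hlt; exact absurd hlt (lt_irrefl _)

omit [Nonempty ι] in
/-- The pair width is non-negative. -/
theorem widthT_nonneg (s : TState ι) (d : ℕ) (C : Finset ℕ) : 0 ≤ s.widthT d C := by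
  unfold widthT; split_ifs
  · exact PairPot.T_nonneg _ _ _
  · exact le_rfl

/-- **Untouched cones keep their potential.** -/
theorem pot2_move_of_not_mem {m : ℕ} {s : TState ι} {R C : Finset ℕ} {d : ℕ} (hC : s.next ∉ C) :
    (s.move m R).pot2 d C = s.pot2 d C := by
  unfold pot2
  have hT : (s.move m R).widthT d C = s.widthT d C := by
    unfold widthT
    by_cases hne : (C.erase d).Nonempty
    · rw [dif_pos hne, dif_pos hne]
      have h1 : (C.erase d).min' hne ≠ s.next := fun h => hC (h ▸ Finset.mem_of_mem_erase (Finset.min'_mem _ hne))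
      have h2 : (C.erase d).max' hne ≠ s.next := fun h => hC (h ▸ Finset.mem_of_mem_erase (Finset.max'_mem _ hne))
      have e1 : (s.move m R).expo ((C.erase d).min' hne) = s.expo ((C.erase d).min' hne) := funext (fun v => move_expo_of_ne h1 v)
      have e2 : (s.move m R).expo ((C.erase d).max' hne) = s.expo ((C.erase d).max' hne) := funext (fun v => move_expo_of_ne h2 v)
      rw [e1, e2]
    · rw [dif_neg hne, dif_neg hne]
  rw [hT, betaSum_move_of_not_mem (fun h => hC (Finset.mem_of_mem_erase h))]

/-- `β` of the new ray of a SINGLETON blow-up `{a}`: `β_ρ = β_a − m`. -/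
theorem beta_move_next_singleton (m : ℕ) (s : TState ι) (a : ℕ) : (s.move m {a}).beta s.next = s.beta a - m := by
  have hex : ∀ v, (s.move m {a}).expo s.next v = s.expo a v - m := by
    intro v; rw [move_expo_next]; unfold faceSum; rw [Finset.sum_singleton]
  apply le_antisymm
  · obtain ⟨v, hv⟩ := s.exists_beta_eq a
    have := (s.move m {a}).beta_le s.next v
    rw [hex v] at this; omega
  · have h : ∀ v, s.beta a - m ≤ (s.move m {a}).expo s.next v := fun v => by
      rw [hex v]; have := s.beta_le a v; omega
    show s.beta a - m ≤ Finset.univ.inf' Finset.univ_nonempty (fun v => (s.move m {a}).expo s.next v)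
    exact Finset.le_inf' _ _ (fun v _ => h v)

/-- A legal singleton has `β ≥ m`. -/
theorem le_beta_of_legal_singleton {m : ℕ} {s : TState ι} {a : ℕ} (h : s.Legal m {a}) : (m : ℤ) ≤ s.beta a := by
  obtain ⟨v, hv⟩ := s.exists_beta_eq a
  have := h.2 v
  unfold faceSum at this; rw [Finset.sum_singleton] at this
  rw [hv]; exact this

/-- **SINGLETON MOVE (translation).**  For a legal member singleton `{a}` (`a ≠ d`) of a cone `C ∋ d` of a well-formed non-negative state, the
child `(C ∖ a) ∪ {ρ}` has the same pair width and a `Σβ` smaller by `m`: its potential is strictly smaller. -/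
theorem pot2_singleton_child_lt {m : ℕ} (hm : 0 < m) {s : TState ι} (hnn : s.Nonneg) (hwf : s.WF) {d : ℕ} (hd : s.DummyRay d)
    {C : Finset ℕ} (hC : C ∈ s.cones) {a : ℕ} (haC : a ∈ C) (had : a ≠ d) (hlegal : s.Legal m {a}) :
    (s.move m {a}).pot2 d (insert s.next (C.erase a)) < s.pot2 d C := by
  have hnC : s.next ∉ C := hwf.next_notMem hC
  have hdC : d ∈ C := hd.1 C hC
  have hnd : s.next ≠ d := fun h => hnC (h ▸ hdC)
  have han : a ≠ s.next := fun h => hnC (h ▸ haC)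
  -- the member pair is `{a, b}`
  obtain ⟨i, j, hij, hCd⟩ := hd.exists_pair hwf hC
  have haij : a ∈ ({i, j} : Finset ℕ) := by rw [← hCd]; exact Finset.mem_erase.mpr ⟨had, haC⟩
  -- normalise so that `a = i`
  obtain ⟨b, hab, hCab⟩ : ∃ b, a ≠ b ∧ C.erase d = {a, b} := by
    simp only [Finset.mem_insert, Finset.mem_singleton] at haij
    rcases haij with rfl | rfl
    · exact ⟨j, hij, hCd⟩
    · exact ⟨i, hij.symm, by rw [hCd, Finset.pair_comm]⟩
  have hbC : b ∈ C := Finset.mem_of_mem_erase (by rw [hCab]; simp : b ∈ C.erase d)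
  have hbn : b ≠ s.next := fun h => hnC (h ▸ hbC)
  -- the child's member pair is `{ρ, b}`
  have hDd : (insert s.next (C.erase a)).erase d = {s.next, b} := by
    rw [erase_child_eq hnd, hCab, pair_erase_left hab]
  have hρb : s.next ≠ b := hbn.symm
  -- pair width: translation
  have hex : (s.move m {a}).expo s.next = fun v => s.expo a v - m := by
    funext v; rw [move_expo_next]; unfold faceSum; rw [Finset.sum_singleton]
  have heb : (s.move m {a}).expo b = s.expo b := funext (fun v => move_expo_of_ne hbn v)
  have hT : (s.move m {a}).widthT d (insert s.next (C.erase a)) = s.widthT d C := by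
    rw [widthT_eq hρb hDd, widthT_eq hab hCab, hex, heb, PairPot.T_translate_left]
  -- Σβ drops by m
  have hB : (s.move m {a}).betaSum ((insert s.next (C.erase a)).erase d) = s.betaSum (C.erase d) - m := by
    rw [hDd, hCab]
    unfold betaSum
    rw [Finset.sum_pair hρb, Finset.sum_pair hab, beta_move_next_singleton, beta_move_of_ne hbn]
    ring
  have hβa := le_beta_of_legal_singleton hlegal
  have hβb := beta_nonneg hnn b
  have hBC : s.betaSum (C.erase d) = s.beta a + s.beta b := by
    rw [hCab]; unfold betaSum; rw [Finset.sum_pair hab]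
  unfold pot2
  rw [hT, hB]
  refine Prod.Lex.lt_iff.mpr (Or.inr ⟨rfl, ?_⟩)
  have hm' : (0 : ℤ) < m := by exact_mod_cast hm
  have h0 : 0 ≤ s.betaSum (C.erase d) - m := by rw [hBC]; omega
  have h1 : s.betaSum (C.erase d) - m < s.betaSum (C.erase d) := by omega
  exact (Int.toNat_lt_toNat (by omega)).mpr h1

omit [Nonempty ι] in
/-- A member singleton of a cone is a face; if it is not legal, some generator has exponent `< m` at that ray. -/
theorem exists_expo_lt_of_not_legal {m : ℕ} {s : TState ι} {C : Finset ℕ} (hC : C ∈ s.cones) {a : ℕ} (haC : a ∈ C)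
    (h : ¬ s.Legal m {a}) : ∃ v, s.expo a v < m := by
  by_contra hall
  apply h
  refine ⟨⟨⟨a, Finset.mem_singleton_self a⟩, C, hC, by rwa [Finset.singleton_subset_iff]⟩, fun v => ?_⟩
  unfold faceSum; rw [Finset.sum_singleton]
  exact not_lt.mp (fun hv => hall ⟨v, hv⟩)

/-- **PAIR MOVE (point blow-up of the member pair).**  Let `C ∋ d` be a cone of a well-formed non-negative dummy-ray state whose two member
singletons are NOT legal (both rays reduced).  Then each child of `C` under the blow-up of the member pair `C ∖ d` has strictly smaller
potential: the pair width drops when positive (brick 4A, non-principal case), and when it vanishes the configuration is principal and `Σβ`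
drops (brick 4A, principal case with reduced minima). -/
theorem pot2_pair_child_lt {m : ℕ} {s : TState ι} (hnn : s.Nonneg) (hwf : s.WF) {d : ℕ} (hd : s.DummyRay d)
    {C : Finset ℕ} (hC : C ∈ s.cones) (hred : ∀ r ∈ C.erase d, ¬ s.Legal m {r}) (hlegal : s.Legal m (C.erase d))
    {x : ℕ} (hx : x ∈ C.erase d) :
    (s.move m (C.erase d)).pot2 d (insert s.next (C.erase x)) < s.pot2 d C := by
  have hnC : s.next ∉ C := hwf.next_notMem hC
  have hdC : d ∈ C := hd.1 C hC
  have hnd : s.next ≠ d := fun h => hnC (h ▸ hdC)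
  have hnn' : (s.move m (C.erase d)).Nonneg := hnn.move hlegal
  -- the member pair `{a, b}` with `x = a`
  obtain ⟨i, j, hij, hCd⟩ := hd.exists_pair hwf hC
  obtain ⟨b, hab, hCab⟩ : ∃ b, x ≠ b ∧ C.erase d = {x, b} := by
    have hxij : x ∈ ({i, j} : Finset ℕ) := hCd ▸ hx
    simp only [Finset.mem_insert, Finset.mem_singleton] at hxij
    rcases hxij with rfl | rfl
    · exact ⟨j, hij, hCd⟩
    · exact ⟨i, hij.symm, by rw [hCd, Finset.pair_comm]⟩
  have haC : x ∈ C := Finset.mem_of_mem_erase hx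
  have had : x ≠ d := (Finset.mem_erase.mp hx).1
  have hbCd : b ∈ C.erase d := by rw [hCab]; simp
  have hbC : b ∈ C := Finset.mem_of_mem_erase hbCd
  have han : x ≠ s.next := fun h => hnC (h ▸ haC)
  have hbn : b ≠ s.next := fun h => hnC (h ▸ hbC)
  -- exponents after the move
  have hex : (s.move m (C.erase d)).expo s.next = fun v => s.expo x v + s.expo b v - m := by
    funext v; rw [move_expo_next, hCab]; unfold faceSum; rw [Finset.sum_pair hab]
  have heb : (s.move m (C.erase d)).expo b = s.expo b := funext (fun v => move_expo_of_ne hbn v)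
  -- the child's member pair is `{ρ, b}` (coordinates `(x + y − m, y)`, the SECOND child map of brick 4A)
  have hDd : (insert s.next (C.erase x)).erase d = {s.next, b} := by
    rw [erase_child_eq hnd, hCab, pair_erase_left hab]
  have hρb : s.next ≠ b := hbn.symm
  have hTC : s.widthT d C = PairPot.T Finset.univ (s.expo x) (s.expo b) := widthT_eq hab hCab
  have hTD : (s.move m (C.erase d)).widthT d (insert s.next (C.erase x)) =
      PairPot.T Finset.univ (fun v => s.expo x v + s.expo b v - m) (s.expo b) := by
    rw [widthT_eq hρb hDd, hex, heb]
  -- reducedness of both rays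
  obtain ⟨vb, hvb⟩ := exists_expo_lt_of_not_legal hC hbC (hred b hbCd)
  -- Σβ of parent and child
  have hBC : s.betaSum (C.erase d) = s.beta x + s.beta b := by
    rw [hCab]; unfold betaSum; rw [Finset.sum_pair hab]
  have hBD : (s.move m (C.erase d)).betaSum ((insert s.next (C.erase x)).erase d) =
      (s.move m (C.erase d)).beta s.next + s.beta b := by
    rw [hDd]; unfold betaSum; rw [Finset.sum_pair hρb, beta_move_of_ne hbn]
  have hβρ : (s.move m (C.erase d)).beta s.next =
      Finset.univ.inf' Finset.univ_nonempty (fun v => s.expo x v + s.expo b v - m) := by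
    unfold beta; rw [hex]
  have hβD_nonneg : 0 ≤ (s.move m (C.erase d)).betaSum ((insert s.next (C.erase x)).erase d) := betaSum_nonneg hnn' _
  unfold pot2
  by_cases hT : 0 < s.widthT d C
  · -- non-principal: the pair width drops
    refine Prod.Lex.lt_iff.mpr (Or.inl ?_)
    have hlt : (s.move m (C.erase d)).widthT d (insert s.next (C.erase x)) < s.widthT d C := by
      rw [hTD, hTC]; rw [hTC] at hT; exact PairPot.T_child2_lt _ _ _ _ hT
    have h0 := widthT_nonneg (s.move m (C.erase d)) d (insert s.next (C.erase x))
    exact (Int.toNat_lt_toNat (by omega)).mpr hlt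
  · -- principal: `T = 0` at parent and child, `Σβ` drops
    have hT0 : s.widthT d C = 0 := le_antisymm (le_of_not_gt hT) (widthT_nonneg s d C)
    have hTD0 : (s.move m (C.erase d)).widthT d (insert s.next (C.erase x)) = 0 := by
      apply le_antisymm _ (widthT_nonneg _ _ _)
      rw [hTD]; rw [hTC] at hT0; rw [← hT0]; exact PairPot.T_child2_le_self _ _ _ _
    rw [hT0, hTD0]
    refine Prod.Lex.lt_iff.mpr (Or.inr ⟨rfl, ?_⟩)
    obtain ⟨v₀, -, hmin⟩ := PairPot.exists_min_of_T_eq_zero (Finset.univ : Finset ι) Finset.univ_nonempty (s.expo x) (s.expo b)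
      (by rw [← hTC]; exact hT0)
    have hredb : s.expo b v₀ < m := lt_of_le_of_lt (hmin vb (Finset.mem_univ _)).2 hvb
    have key := PairPot.minsum_child2_lt (Finset.univ : Finset ι) (s.expo x) (s.expo b) (m : ℤ) (Finset.mem_univ v₀) hmin hredb
    have hlt : (s.move m (C.erase d)).betaSum ((insert s.next (C.erase x)).erase d) < s.betaSum (C.erase d) := by
      rw [hBD, hβρ, hBC]
      exact key
    exact (Int.toNat_lt_toNat (by omega)).mpr hlt

end Potential

end TState

end Summit.ResolutionOfSingularities.ResolutionOfSingularities.Theorems.CampaignW42.Toric
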